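import Literature.IUT.HodgeTheaters.InitialThetaData
import Literature.IUT.HodgeTheaters.PuncturedEllipticCoveringsBasic
import HarnessLib

/-!
# [IUTchI] Definition 3.1 (e), (f): base change of the arithmetic fundamental groups of initial Θ-data
# (`Π_{(−)_v̲} := Π_{(−)} ×_{G_F} G_v̲`, in particular `Π_v̲ := Π_{X̲→_v̲}`)

S. Mochizuki, *Inter-universal Teichmüller theory I*, §3, Definition 3.1 (e), (f) (kurims final manuscript,
May 2020, pp. 62–63) [claim: Mochizuki2012, status: disputed]. DEFINITIONS over the REAL `InitialThetaData` of
`InitialThetaData.lean` (abc-iut-L5-t2); nothing of the series is asserted.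

Print, Def. 3.1 (e) pp. 62–63: "for each `v̲ ∈ V(K)`, we shall use the subscript `v̲` to denote the result of
base-changing hyperbolic orbicurves over `F` or `K` to `K_v̲`. Thus … we have natural cartesian diagrams
`X̲_v̲ → X_v̲ → X_v`, … `Δ_X → Π_{X̲_v̲} → Π_{X_v}` … of profinite étale coverings of hyperbolic orbicurves and
corresponding injections of profinite groups [étale fundamental groups] … the various profinite groups `Π_(−)`
admit natural outer surjections onto the decomposition group `G_v ⊆ G_K := Gal(F̄/K)` determined, up to
`G_K`-conjugacy, by `v`"; (f) p. 63: "the data `(X_K, C̲_K, ε̲)` determines … open subgroups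
`Π_{X̲→_K} ⊆ Π_{C̲→_K} ⊆ Π_{C_F}` … and, for `v ∈ V̲^good`, `Π_{X̲→_v} ⊆ Π_{C̲→_v} ⊆ Π_{C_v}`. If
`v ∈ V̲^good`, then we shall write `Π_v := Π_{X̲→_v}`."

What is CONSTRUCTED here, for `D : InitialThetaData F K Fbar E l P`, a subgroup `H = Π_{(−)} ⊆ Π_{C_F}` and a
homomorphism `ρ : Γ →* G_F` from a topological group `Γ` (in print `Γ = Gal(K̄_v̲/K_v̲)` and `ρ` = the
restriction along an embedding `F̄ ↪ K̄_v̲`, whose image is the decomposition group `G_v̲ ⊆ G_K` — typed in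
`InitialThetaDataLocalGalois.lean` as `localToGF F K_v̲ ι`, Krull-continuous, image `decompositionSubgroupGF`):
* `D.augGF : Π_{C_F} ↠ G_F` (augmentation followed by `galIso`): continuous, surjective, OPEN (`isOpenMap_augGF`);
  `D.galoisSubgroupOf_le_map_PiXarrow` = "`Π_{X̲→_K} ↠ G_K`" (from abc-iut-L5-t1's
  `PuncturedEllipticData.aug_piXarrow_surjective` and the fields `galKIso`, `aug_compat`, `embK` of
  `ThetaGeometry`); `D.map_augGF_PiX` = "`Π_{X_F} ↠ G_F`";
* **`D.PiLoc H ρ` = `Π_{(−)_v̲} := Π_{(−)} ×_{G_F} Γ`**, the base change of `Π_{(−)}` along `ρ`, as the subgroup of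
  `Π_{C_F} × Γ` of pairs `(x, σ)` with `x ∈ Π_{(−)}` and `augGF x = ρ σ`: for `H = Π_{X̲→_K}` (`D.PiXarrow`) and
  `v̲ ∈ V̲^good` this is **`Π_v̲ := Π_{X̲→_v̲}`** of (f); for `H = Π_{X_K}, Π_{C_K}, Π_{X̲_K}, Π_{C̲_K}, Π_{C̲→_K}` it is
  `Π_{X_v̲}, Π_{C_v̲}, Π_{X̲_v̲}, Π_{C̲_v̲}, Π_{C̲→_v̲}` of the cartesian diagrams of (e)/(f) (`PiLoc_mono` gives the
  inclusions); with the "natural surjection onto the decomposition group" `D.augLoc H ρ : Π_{(−)_v̲} →* Γ`: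
  CONTINUOUS, SURJECTIVE as soon as `ρ(Γ) ⊆ augGF(Π_{(−)})` (`augLoc_surjective`; e.g. `ρ(Γ) ⊆ G_K` and
  `Π_{(−)} ↠ G_K`), OPEN when `Π_{(−)}` is open and `ρ` continuous (`isOpenMap_augLoc`; for `Π_{X̲→_K}` the
  printed clause (f) "open subgroups `Π_{X̲→_K} ⊆ … ⊆ Π_{C_F}`" is a HYPOTHESIS — the frozen structure does not
  record it), with kernel `Δ_{(−)} := Π_{(−)} ∩ Δ_C` ("`Δ_X → Π_{X̲_v̲}`": the geometric fundamental group is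
  unchanged by base change, `kerAugLocEquiv`) and image in `Π_{C_F}` the decomposition subgroup
  `Π_{(−)} ∩ augGF⁻¹(ρ(Γ))` (`range_fstLoc`).
The instantiation `Γ := Gal(K̄_v̲/K_v̲)` and [IUTchI] Example 3.3 (i)–(ii) AT THE DATUM (`D_v̲ = 𝓑(Π_v̲)⁰`) is the
sibling `InitialThetaDataGoodLocalFrobenioid.lean`.

MODELLING NOTES. (1) `Π_{X̲→_v̲}` is typed as the fibre product `Π_{X̲→_K} ×_{G_K} Gal(K̄_v̲/K_v̲)` — the
base-change formula for arithmetic fundamental groups (the geometric fundamental group is unchanged under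
`F̄ ⊂ K̄_v̲`, cf. the "injections" `Δ_X → Π_{X̲_v̲}` of (e)); injectivity of `Gal(K̄_v̲/K_v̲) → G_K` (Krasner; the
tree's `Literature.NumberTheory.EllipticCurves.resGalAux_injective_holds`) is not used. (2) At `v̲ ∈ V̲^bad`
print's `Π_v̲` is the TEMPERED group of the model `X̲̲_v̲` (Ex. 3.2, Rmk. 3.1.1), not this construction.
No statement of the paper is strengthened.
-/

noncomputable section

namespace Literature.IUT.HodgeTheaters

universe u v w w'

/-! ### Definition 3.1 (e), (f) for initial Θ-data: `Π_{C_F} ↠ G_F`, `Π_v̲ := Π_{X̲→_v̲}` -/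

section LocalBasic

variable {F : Type u} {K : Type v} {Fbar : Type w} [Field F] [NumberField F] [Field K] [NumberField K]
  [Algebra F K] [Field Fbar] [Algebra F Fbar] [Algebra K Fbar]
  {E : WeierstrassCurve F} [E.IsElliptic] {l : ℕ} {Pb : BadPlacePredicates K}
  (D : InitialThetaData F K Fbar E l Pb)

namespace InitialThetaData

include D in
/-- `F̄/K` is normal (`F̄` is an algebraic closure of `F ⊆ K ⊆ F̄`): the instance hypothesis
`[Normal K Fbar]` of this file, discharged from the datum. [claim: Mochizuki2012, status: disputed] -/
theorem normal_K : Normal K Fbar := by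
  haveI := D.isAlgClosure
  haveI := D.isScalarTower
  haveI : Normal F Fbar := IsAlgClosure.normal F Fbar
  exact Normal.tower_top_of_normal F K Fbar

/-- `Π_{C_F} ↠ G_F = Gal(F̄/F)`: the augmentation of `Π_{C_F}` followed by the identification `galIso`
(Def. 3.1 (b)). [claim: Mochizuki2012, status: disputed] -/
def augGF : D.PiC →* (Fbar ≃ₐ[F] Fbar) := D.geom.galIso.toMonoidHom.comp D.geom.extF.aug.toMonoidHom

/-- Values of `augGF`. [claim: Mochizuki2012, status: disputed] -/
theorem augGF_apply (x : D.PiC) : D.augGF x = D.geom.galIso (D.geom.extF.aug x) := rfl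

/-- `Π_{C_F} → G_F` is continuous. [claim: Mochizuki2012, status: disputed] -/
theorem continuous_augGF : Continuous D.augGF :=
  D.geom.galIso_continuous.1.comp (map_continuous D.geom.extF.aug)

/-- `Π_{C_F} ↠ G_F` is surjective. [claim: Mochizuki2012, status: disputed] -/
theorem augGF_surjective : Function.Surjective D.augGF :=
  D.geom.galIso.surjective.comp D.geom.extF.aug_surjective

/-- `Π_{C_F} → G_F` is an OPEN map: a continuous surjective homomorphism of profinite groups is a quotient
map, hence open, and `galIso` is a homeomorphism. [claim: Mochizuki2012, status: disputed] -/
theorem isOpenMap_augGF : IsOpenMap D.augGF := by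
  have h1 : IsOpenMap D.geom.extF.aug :=
    (MonoidHom.isOpenQuotientMap_of_isQuotientMap (φ := D.geom.extF.aug)
      (IsClosedMap.isQuotientMap (map_continuous D.geom.extF.aug).isClosedMap
        (map_continuous D.geom.extF.aug) D.geom.extF.aug_surjective)).isOpenMap
  have h2 : IsOpenMap D.geom.galIso :=
    (Homeomorph.mk D.geom.galIso.toEquiv D.geom.galIso_continuous.1 D.geom.galIso_continuous.2).isOpenMap
  exact h2.comp h1

/-- `augGF x = 1 ↔ x ∈ Δ_C` (`galIso` is injective). [claim: Mochizuki2012, status: disputed] -/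
theorem augGF_eq_one_iff (x : D.PiC) : D.augGF x = 1 ↔ x ∈ D.DeltaC := by
  rw [augGF_apply, map_eq_one_iff _ D.geom.galIso.injective]
  exact D.geom.extF.mem_geom.symm

/-- **`Π_{X̲→_K} ↠ G_K`**: every element of `G_K ⊆ G_F` is the image under `augGF` of an element of `Π_{X̲→_K}`
(abc-iut-L5-t1's `PuncturedEllipticData.aug_piXarrow_surjective` — from the datum `D_{2ε} ↠ G_k` of §1 —
transported through `embK`, `galKIso`, `aug_compat`). [claim: Mochizuki2012, status: disputed] -/
theorem galoisSubgroupOf_le_map_PiXarrow : galoisSubgroupOf F K Fbar ≤ D.PiXarrow.map D.augGF := by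
  intro g hg
  obtain ⟨y, hy⟩ := D.geom.pe.aug_piXarrow_surjective (D.geom.galKIso.symm ⟨g, hg⟩)
  refine ⟨D.geom.embK y, Subgroup.mem_map_of_mem _ y.2, ?_⟩
  rw [augGF_apply, D.geom.aug_compat]
  change ((D.geom.galKIso ((D.geom.pe.E.aug.toMonoidHom.comp D.geom.pe.piXarrow.subtype) y) :
    galoisSubgroupOf F K Fbar) : Fbar ≃ₐ[F] Fbar) = g
  rw [hy, MulEquiv.apply_symm_apply]

/-- **`Π_{X_F} ↠ G_F`** (Def. 3.1 (b), field `aug_PiX` of `ThetaGeometry`): `augGF(Π_{X_F}) = G_F`.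
[claim: Mochizuki2012, status: disputed] -/
theorem map_augGF_PiX : D.geom.PiX.map D.augGF = ⊤ := by
  rw [augGF, ← Subgroup.map_map, D.geom.aug_PiX, ← MonoidHom.range_eq_map,
    MonoidHom.range_eq_top.mpr D.geom.galIso.surjective]

end InitialThetaData

end LocalBasic

section Local

variable {F : Type u} {K : Type v} {Fbar : Type w} [Field F] [NumberField F] [Field K] [NumberField K]
  [Algebra F K] [Field Fbar] [Algebra F Fbar] [Algebra K Fbar]
  {E : WeierstrassCurve F} [E.IsElliptic] {l : ℕ} {Pb : BadPlacePredicates K}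
  (D : InitialThetaData F K Fbar E l Pb) (H : Subgroup D.PiC)
  {Γ : Type w'} [Group Γ] (ρ : Γ →* (Fbar ≃ₐ[F] Fbar))

namespace InitialThetaData

/-- **Def. 3.1 (e)/(f): base change to `K_v̲` of a subgroup `Π_{(−)} ⊆ Π_{C_F}`**, `Π_{(−)_v̲} := Π_{(−)} ×_{G_F} Γ` ("for each `v̲ ∈ V(K)`, we shall use the subscript `v̲` to denote the result of base-changing hyperbolic
orbicurves over `F` or `K` to `K_v̲` … natural cartesian diagrams … natural outer surjections onto the
decomposition group `G_v ⊆ G_K`"), as the subgroup of `Π_{C_F} × Γ` of pairs `(x, σ)` with `x ∈ Π_{(−)}` and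
`augGF x = ρ σ` (`= σ|_{F̄}` for `Γ = Gal(K̄_v̲/K_v̲)`); for `H = Π_{X̲→_K}` (`D.PiXarrow`) and `v̲ ∈ V̲^good` this is **`Π_v̲ := Π_{X̲→_v̲}`** ((f): "if
`v ∈ V̲^good`, then we shall write `Π_v := Π_{X̲→_v}`"); for `H = Π_{X_K}, Π_{C_K}, Π_{X̲_K}, Π_{C̲_K}` it is
`Π_{X_v̲}, Π_{C_v̲}, Π_{X̲_v̲}, Π_{C̲_v̲}` of (e). [claim: Mochizuki2012, status: disputed] -/
def PiLoc : Subgroup (D.PiC × Γ) :=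
  H.comap (MonoidHom.fst D.PiC Γ) ⊓
    MonoidHom.eqLocus (D.augGF.comp (MonoidHom.fst D.PiC Γ))
      ((ρ).comp (MonoidHom.snd D.PiC Γ))

/-- Membership in `Π_{(−)_v̲}`. [claim: Mochizuki2012, status: disputed] -/
theorem mem_PiLoc (z : D.PiC × Γ) :
    z ∈ D.PiLoc H ρ ↔ z.1 ∈ H ∧ D.augGF z.1 = ρ z.2 := Iff.rfl

/-- **The natural surjection `Π_{(−)_v̲} ↠ G_v̲`** (Def. 3.1 (e); `Γ = Gal(K̄_v̲/K_v̲) ↠ G_v̲`): the second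
projection. [claim: Mochizuki2012, status: disputed] -/
def augLoc : D.PiLoc H ρ →* Γ := (MonoidHom.snd D.PiC Γ).comp (D.PiLoc H ρ).subtype

/-- `Π_{(−)_v̲} → Π_{C_F}` (first projection; image in `Π_{(−)}`), the "`Π_{X̲_v̲} → Π_{X_v}`"-direction of the
cartesian diagrams of Def. 3.1 (e). [claim: Mochizuki2012, status: disputed] -/
def fstLoc : D.PiLoc H ρ →* D.PiC := (MonoidHom.fst D.PiC Γ).comp (D.PiLoc H ρ).subtype

/-- Values of `augLoc`. [claim: Mochizuki2012, status: disputed] -/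
@[simp] theorem augLoc_apply (z : D.PiLoc H ρ) : D.augLoc H ρ z = z.1.2 := rfl

/-- Values of `fstLoc`. [claim: Mochizuki2012, status: disputed] -/
@[simp] theorem fstLoc_apply (z : D.PiLoc H ρ) : D.fstLoc H ρ z = z.1.1 := rfl

/-- `fstLoc` lands in `Π_{(−)}`. [claim: Mochizuki2012, status: disputed] -/
theorem fstLoc_mem (z : D.PiLoc H ρ) : D.fstLoc H ρ z ∈ H := ((D.mem_PiLoc H ρ z.1).mp z.2).1

/-- Compatibility of the two projections: `augGF ∘ fstLoc = localToGF ∘ augLoc` (the square over `G_F`).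
[claim: Mochizuki2012, status: disputed] -/
theorem augGF_fstLoc (z : D.PiLoc H ρ) :
    D.augGF (D.fstLoc H ρ z) = ρ (D.augLoc H ρ z) :=
  ((D.mem_PiLoc H ρ z.1).mp z.2).2

/-- **`Π_{(−)_v̲} ↠ Γ` is SURJECTIVE** as soon as `augGF(Π_{(−)}) ⊇ ρ(Γ)` ("natural outer surjections onto the
decomposition group"; e.g. `ρ(Γ) ⊆ G_K ⊆ augGF(Π_{X̲→_K})` by `galoisSubgroupOf_le_map_PiXarrow`, or `map_augGF_PiX`
for `Π_{X_F}`). [claim: Mochizuki2012, status: disputed] -/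
theorem augLoc_surjective (hH : ρ.range ≤ H.map D.augGF) : Function.Surjective (D.augLoc H ρ) := by
  intro σ
  obtain ⟨x, hx, hxσ⟩ := hH ⟨σ, rfl⟩
  exact ⟨⟨(x, σ), (D.mem_PiLoc H ρ _).mpr ⟨hx, hxσ⟩⟩, rfl⟩

/-- Membership in the kernel of `Π_{(−)_v̲} ↠ Γ`: the `Gal`-component is trivial.
[claim: Mochizuki2012, status: disputed] -/
theorem mem_ker_augLoc (z : D.PiLoc H ρ) : z ∈ (D.augLoc H ρ).ker ↔ z.1.2 = 1 := Iff.rfl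

/-- **`Ker(Π_{(−)_v̲} ↠ G_v̲) ≅ Δ_{(−)} := Π_{(−)} ∩ Δ_C`** (the injection "`Δ_X → Π_{X̲_v̲}`" of the cartesian
diagrams of Def. 3.1 (e): the geometric fundamental group is unchanged by the base change `K ↪ K_v̲`).
[claim: Mochizuki2012, status: disputed] -/
def kerAugLocEquiv : (D.augLoc H ρ).ker ≃* (H ⊓ D.DeltaC : Subgroup D.PiC) where
  toFun z := ⟨z.1.1.1, Subgroup.mem_inf.mpr ⟨((D.mem_PiLoc H ρ z.1.1).mp z.1.2).1,
    (D.augGF_eq_one_iff _).mp (by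
      rw [((D.mem_PiLoc H ρ z.1.1).mp z.1.2).2, show z.1.1.2 = 1 from (D.mem_ker_augLoc H ρ z.1).mp z.2,
        map_one])⟩⟩
  invFun x := ⟨⟨(x.1, 1), (D.mem_PiLoc H ρ _).mpr ⟨(Subgroup.mem_inf.mp x.2).1, by
    rw [map_one, (D.augGF_eq_one_iff _).mpr (Subgroup.mem_inf.mp x.2).2]⟩⟩,
    (D.mem_ker_augLoc H ρ _).mpr rfl⟩
  left_inv z := by
    apply Subtype.ext
    apply Subtype.ext
    exact Prod.ext rfl ((D.mem_ker_augLoc H ρ z.1).mp z.2).symm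
  right_inv _ := rfl
  map_mul' _ _ := rfl

/-- Values of `kerAugLocEquiv`: the `Π_{C_F}`-component. [claim: Mochizuki2012, status: disputed] -/
@[simp] theorem coe_kerAugLocEquiv (z : (D.augLoc H ρ).ker) :
    (D.kerAugLocEquiv H ρ z : D.PiC) = z.1.1.1 := rfl

/-- **The image of `Π_{(−)_v̲}` in `Π_{C_F}`** is the decomposition subgroup `Π_{(−)} ∩ augGF⁻¹(ρ(Γ))` of `Π_{(−)}`
("`Π_{(−)} ×_{G_K} G_v̲ ⊆ Π_{(−)}`", `ρ(Γ) = G_v̲`). [claim: Mochizuki2012, status: disputed] -/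
theorem range_fstLoc : (D.fstLoc H ρ).range = H ⊓ ρ.range.comap D.augGF := by
  ext x
  constructor
  · rintro ⟨z, rfl⟩
    have hz := (D.mem_PiLoc H ρ z.1).mp z.2
    exact Subgroup.mem_inf.mpr ⟨hz.1, Subgroup.mem_comap.mpr (MonoidHom.mem_range.mpr ⟨z.1.2, hz.2.symm⟩)⟩
  · intro hx
    obtain ⟨hx1, hx2⟩ := Subgroup.mem_inf.mp hx
    obtain ⟨σ, hσ⟩ := MonoidHom.mem_range.mp (Subgroup.mem_comap.mp hx2)
    exact ⟨⟨(x, σ), (D.mem_PiLoc H ρ _).mpr ⟨hx1, hσ.symm⟩⟩, rfl⟩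

/-- `Π_{(−)_v̲}` is functorial in `Π_{(−)}`: an inclusion `Π_{(−)} ⊆ Π_{(−)'}` gives `Π_{(−)_v̲} ⊆ Π_{(−)'_v̲}` (the
inclusions `Π_{X̲→_v} ⊆ Π_{C̲→_v} ⊆ Π_{C_v}` of Def. 3.1 (f), `Π_{X̲_v̲} → Π_{X_v̲}` of (e)).
[claim: Mochizuki2012, status: disputed] -/
theorem PiLoc_mono {H H' : Subgroup D.PiC} (h : H ≤ H') : D.PiLoc H ρ ≤ D.PiLoc H' ρ :=
  fun _ hz => ⟨h hz.1, hz.2⟩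

variable [TopologicalSpace Γ]

/-- `Π_{(−)_v̲} → Γ` is continuous. [claim: Mochizuki2012, status: disputed] -/
theorem continuous_augLoc : Continuous (D.augLoc H ρ) := continuous_snd.comp continuous_subtype_val

/-- `Π_{(−)_v̲} → Π_{C_F}` is continuous. [claim: Mochizuki2012, status: disputed] -/
theorem continuous_fstLoc : Continuous (D.fstLoc H ρ) := continuous_fst.comp continuous_subtype_val

/-- **`Π_{(−)_v̲} ↠ Γ` is OPEN** when `Π_{(−)} ⊆ Π_{C_F}` is open (for `Π_{X̲→_K}`: the printed clause
Def. 3.1 (f) "open subgroups `Π_{X̲→_K} ⊆ … ⊆ Π_{C_F}`"): the image of a basic open `(V₁ × V₂) ∩ Π_{(−)_v̲}` is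
`V₂ ∩ ρ⁻¹(augGF(V₁ ∩ Π_{(−)}))`, open because `augGF` is open and `ρ` continuous.
[claim: Mochizuki2012, status: disputed] -/
theorem isOpenMap_augLoc (hX : IsOpen (H : Set D.PiC)) (hρ : Continuous ρ) : IsOpenMap (D.augLoc H ρ) := by
  intro U hU
  obtain ⟨V, hV, rfl⟩ := isOpen_induced_iff.mp hU
  rw [isOpen_iff_forall_mem_open]
  rintro _ ⟨z, hzV, rfl⟩
  have hz := (D.mem_PiLoc H ρ z.1).mp z.2
  obtain ⟨V₁, V₂, hV₁, hV₂, h1, h2, hsub⟩ := isOpen_prod_iff.mp hV z.1.1 z.1.2 hzV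
  refine ⟨V₂ ∩ ρ ⁻¹' (D.augGF '' (V₁ ∩ (H : Set D.PiC))), ?_, ?_, ?_⟩
  · rintro σ' ⟨hσ'₂, x', ⟨hx'₁, hx'X⟩, hx'⟩
    exact ⟨⟨(x', σ'), (D.mem_PiLoc H ρ _).mpr ⟨hx'X, hx'⟩⟩, hsub (Set.mk_mem_prod hx'₁ hσ'₂), rfl⟩
  · exact hV₂.inter ((D.isOpenMap_augGF _ (hV₁.inter hX)).preimage hρ)
  · exact ⟨h2, z.1.1, ⟨h1, hz.1⟩, hz.2⟩

end InitialThetaData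

end Local

end Literature.IUT.HodgeTheaters

end
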